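/-
Copyright (c) 2026 the pub-hodgecm-mathlib formalisation cell (harness21).  Prover seat hodgecm-mathlib-LH7-p06 (g0) (re-dealt to strike line L3 `stub_N6nsDyadic` by director
s1969 (a); heir LEAD F0P3a-plan (g21) T20-16 (d)), «(D-RAM) FOUR-FRAME» road of crux H413, line LH4, (β-BAL) Stage B, β-BOARD v1 (sub-dealer LH4-p05 (g8)) ROW R2 «G₃ PURE»,
sub-row (P2a) INFRASTRUCTURE of LH4-p11 (g8)'s `VERDICT-G3row.v1.LH4p11g8.md` b6c59e931782b40f §3 (m2)(m3): the per-lattice letters of the stratum `G₃ = (2ρ+s, 2ρ+s, 2ρ)`.  2026-09-04.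
-/
import Summits.HodgeConjecture.HodgeConjecture.Theorems.F0P3cDyRamDiagonalStrataShapes    -- ★ (LH4-p04 (g2)) B3: `dualisable_strata` (via part 2), `hasAxis_latt_hnf_G3`, `hasAxis_unique`; brings ★ HNF ∕ HNFExists ∕ DualFrameValues ∕ StrataDefs
import Summits.HodgeConjecture.HodgeConjecture.Theorems.F0P3cDyRamDiagonalHNFStability     -- ★ p855216 (LH4-p14): `mapGL_latt_hnf_eq_iff` (T-stability of a column-HNF lattice)
import HarnessLib

/-!
# Crux `H413`, line LH4 «(D-RAM) FOUR-FRAME» — (β-BAL) Stage B, β-BOARD v1 ROW R2 «G₃ PURE», (P2a) INFRASTRUCTURE: the stratum `G₃ = (2ρ+s, 2ρ+s, 2ρ)` per lattice —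
# the glued normal form `latt (1 0 0; x ϖ^{ρ+s} 0; y z ϖ^{2ρ})`, its polarisation valuations, the Gram cancellation `|D₀ + D₁N(x)| = exp 2ρ`, and the fixed diagonal stabiliser

Cell `hodgecm-mathlib` (D-0151), FLOOR 0, crux item H413 = `stmt-HodgeConjecture-24833`, route `HCCMUnconditional`; squad F0∕P3c∕LH4 (this seat re-dealt from F0∕P3c∕LH7).
THEOREMS ONLY (no `def`, no instance, no notation, no `sorry`, default heartbeats); ★-only imports; lane `--supports stmt-HodgeConjecture-24833 --as helper` (count-neutral);
pays NO row, states NO law.  This is the G₃ twin of the ★ G₁ per-lattice infrastructure (★ `F0P3cDyRamDiagonalGluedStratum.stratum_G1_eq` (F0P3-p01 (g31)),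
★ `F0P3cDyRamLabelledOddPureStrataG1.v_polarisation_latt_G1` (LH4-p11 (g8)), ★ `F0P3cDyRamDiagonalGluedFixedStabiliser.mem_fixedUnitStabilizer_latt_glued_iff` (F0P3-p01 (g31)))
that LH4-p11 (g8)'s verdict memo lists as MISSING for the (P2a) per-lattice read of the β-table row G₃ (items (m2), (m3); item (m1) «explicit polarisation» is NOT needed by a
read that consumes the abstract polarisation of `IsDualisableLattice`, exactly as ★ FILE 2b does on G₁ — §2 below pins its three valuations instead).

THE MATHEMATICS (LH4-p10 (g2) MEMO v2 §1∕§3; LH4-p11 (g8) VERDICT-G3row §1).  `stratum σ ϖ T a` (★ `F0P3cDyRamDiagonalStrataDefs`) is the set of normalised `T`-stable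
lattices that are dualisable (self-dual for some `σ`-fixed non-degenerate diagonal form `diag(D)`) and have axis vector `a`.  For `a = (2ρ+s, 2ρ+s, 2ρ)` with `ρ, s ≥ 1`:
* §1 (m3) «THE STRATUM IS THE G₃ NORMAL-FORM SET».  (⊆) the HNF model `(1 0 0; x ϖ^b 0; y z ϖ^c)` of a member (★ `exists_latt_eq_latt_hnf`) lies in one of the eight strata of
  ★ B3 `dualisable_strata`; comparing axis vectors (★ `hasAxis_latt_hnf_*`, ★ `hasAxis_unique`) only `G₃(ρ, s)` survives: `b = ρ+s`, `c = 2ρ`, `|x| = |y| = 1`, `|z| = |ϖ|^ρ`,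
  `s ≥ 2` EVEN.  (⊇) such a frame is a `GL₃` lattice (`det = ϖ^{3ρ+s}`), normalised, with axis vector `(2ρ+s, 2ρ+s, 2ρ)` (★ `hasAxis_latt_hnf_G3`).  Heads:
  `exists_hnf_of_mem_stratum_G3`, **`stratum_G3_eq`**, `two_dvd_of_mem_stratum_G3`, `stratum_G3_eq_empty_of_odd`.  (Unlike G₁ there is no glued cancellation letter: the
  corner entries `y, z` are free of valuations `1` and `|ϖ|^ρ`.)
* §2 «POLARISATION VALUATIONS».  If the G₃ normal form is a type-`0` vertex lattice of `diag(D)` (`D_i ≠ 0`), then `|D₀| = |D₁| = exp(2ρ+s)` and `|D₂| = exp 2ρ` — the axis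
  exponents (★ `dualFrame_values` at `(b, c) = (ρ+s, 2ρ)`: `|D₁| = max(exp(ρ+s), |z|·exp(3ρ+s))`, `|D₀| = max(1, exp(ρ+s), |xz − yϖ^{ρ+s}|·exp(3ρ+s))`, `|xz − yϖ^{ρ+s}| = |ϖ|^ρ`).
  Head: **`v_polarisation_latt_G3`** (and `isNormalisedLattice_latt_G3`).
* §3 «THE GRAM CANCELLATION» (VERDICT-G3row §1, the step that makes G₃ one-slot in the pure range): the `(0,0)` Gram entry `D₀ + σx·D₁·x + σy·D₂·y` of the HNF basis is integral
  (★ `gram_values`) while `|σy·D₂·y| = exp 2ρ > 1`, hence `|D₀ + σx·D₁·x| = exp 2ρ` EXACTLY — two polarisation coefficients of valuation `exp(2ρ+s)` cancel down by `s` conductor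
  steps.  Heads: **`v_gram_cancel_latt_G3_le`**, `v_gram_cancel_latt_G3_eq`.
* §4 (m2) «THE FIXED DIAGONAL STABILISER».  ★ `mapGL_latt_hnf_eq_iff` at `(b, c) = (ρ+s, 2ρ)` reads, for units `u`: `diag(u)·M = M ⟺ (a) |u₁−u₀| ≤ |ϖ|^{ρ+s} ∧ (b) |u₂−u₁| ≤ |ϖ|^ρ
  ∧ (c) |(u₂−u₀)·y·ϖ^{ρ+s} + (u₀−u₁)·x·z| ≤ |ϖ|^{3ρ+s}`.  Heads: `det_latt_G3_ne_zero`, `mapGL_latt_G3_eq_iff`, `mem_latticeStabilizer_latt_G3_iff`, `mem_unitStabilizer_latt_G3_iff`,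
  **`mem_fixedUnitStabilizer_latt_G3_iff`**, and the corollary the read uses, **`v_sub_le_of_mem_fixedUnitStabilizer_latt_G3`** (`u ∈ S_F(M) ⟹ (a) ∧ (b) ∧ |u₂−u₀| ≤ |ϖ|^ρ`).
USE (VERDICT-G3row §1, for the (P2a) reader): on `u ∈ S_F(M)` the top value of the label form `A(u) = D₀u₀(α−1) + D₁u₁N(x)(β−1)` rewrites as
`−u₀D₀(β−α) + u₀(D₀ + D₁N(x))(β−1) + (u₁−u₀)D₁N(x)(β−1)`; §3 and §4 (a) make the last two terms `ϖ^{m*}`-small in the cell `2ρ + m* ≤ n₁`, §2 gives `|D₀·π₀^{ρ+s∕2}| = 1` for the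
tower token of `β − α`.
HONEST LABEL.  Count-neutral (`--supports`); nothing printed is asserted; row R2, the table identity (SIG-B2b3), (β-BAL), (β), T₊ remain OPEN; `HC_CM` is proved only modulo the 7
printed citations (2 remaining named inputs: hLiu418 = `stmt-HodgeConjecture-24832`, h413 = `stmt-HodgeConjecture-24833`) until rung 0 closes.

## References
* [Kottwitz1986BaseChangeUnits] R. E. Kottwitz, *Base change for unit elements of Hecke algebras*, Compositio Math. 60 (1986), §1 pp. 240–241 (fixed-lattice counting by position;
  torus stabilisers).
* [Jacobowitz1962] R. Jacobowitz, *Hermitian forms over local fields*, Amer. J. Math. 84 (1962), §4, §7 (Gram matrices of unimodular lattices).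
* [Serre1980Trees] J.-P. Serre, *Trees*, Springer (1980), Ch. II §1.1 (lattices `g·𝒪^N`, Hermite normal forms, coordinate axes).
-/

set_option autoImplicit false

noncomputable section

namespace Summit.HodgeConjecture.HodgeConjecture.Cruxes.H413.F0P3cDyRamDiagonalGluedStratumG3

open Matrix
open Literature.NumberTheory.Automorphic Literature.NumberTheory.Automorphic.HermitianLattice
open Literature.NumberTheory.Automorphic.UnitaryLatticeTree
open Summit.HodgeConjecture.HodgeConjecture.Cruxes.H413.F0P3cDyRamDiagonalTorusDefs
open Summit.HodgeConjecture.HodgeConjecture.Cruxes.H413.F0P3cDyRamDiagonalStrataDefs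
open Summit.HodgeConjecture.HodgeConjecture.Cruxes.H413.F0P3cDyRamDiagonalStableLatticeHNF
open Summit.HodgeConjecture.HodgeConjecture.Cruxes.H413.F0P3cDyRamDiagonalStableLatticeHNFExists
open Summit.HodgeConjecture.HodgeConjecture.Cruxes.H413.F0P3cDyRamDiagonalDualisableStrata
open Summit.HodgeConjecture.HodgeConjecture.Cruxes.H413.F0P3cDyRamDiagonalStrataAxis
open Summit.HodgeConjecture.HodgeConjecture.Cruxes.H413.F0P3cDyRamDiagonalStrataShapes
open Summit.HodgeConjecture.HodgeConjecture.Cruxes.H413.F0P3cDyRamDiagonalHNFDualFrameValues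
open Summit.HodgeConjecture.HodgeConjecture.Cruxes.H413.F0P3cDyRamDiagonalHNFStability
open scoped Valued WithZero Matrix MatrixGroups

variable {K : Type*} [Field K] [Valued K ℤᵐ⁰]

/-! ## §1  (m3) The stratum `(2ρ+s, 2ρ+s, 2ρ)` is the set of G₃ normal forms -/

/-- **(⊆) A MEMBER OF THE STRATUM `(2ρ+s, 2ρ+s, 2ρ)` IS A G₃ NORMAL FORM**: `M = (1 0 0; x ϖ^{ρ+s} 0; y z ϖ^{2ρ})·𝒪³` with `|x| = |y| = 1`, `|z| = |ϖ^ρ|`, and `s ≥ 2` is EVEN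
(★ HNF + ★ B3 `dualisable_strata` + ★ axis vectors + ★ `hasAxis_unique`; `ρ, s ≥ 1` rule out the seven other strata).
[cite: Kottwitz1986BaseChangeUnits, §1 pp. 240–241] [cite: Serre1980Trees, Ch. II §1.1] -/
theorem exists_hnf_of_mem_stratum_G3 {σ : K →+* K} (hvσ : ∀ a, Valued.v (σ a) = Valued.v a)
    (hfix : ∀ x : K, σ x = x → x ≠ 0 → ∃ n : ℤ, Valued.v x = WithZero.exp (2 * n)) {ϖ : K} (hϖ : Valued.v ϖ = WithZero.exp (-1 : ℤ))
    (T : GL (Fin 3) K) {ρ s : ℕ} (hρ : 1 ≤ ρ) (hs : 1 ≤ s) {M : Submodule 𝒪[K] (Fin 3 → K)} (hM : M ∈ stratum σ ϖ T ![2 * ρ + s, 2 * ρ + s, 2 * ρ]) :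
    ∃ x y z : K, Valued.v x = 1 ∧ Valued.v y = 1 ∧ Valued.v z = Valued.v (ϖ ^ ρ) ∧ 2 ∣ s ∧ 2 ≤ s ∧
      M = latt (Matrix.of ![![1, 0, 0], ![x, ϖ ^ (ρ + s), 0], ![y, z, ϖ ^ (2 * ρ)]]) ∧ mapGL T M = M ∧ IsDualisableLattice σ ϖ M := by
  obtain ⟨hM0, hdual, ha⟩ := (mem_stratum_iff σ ϖ T _ M).1 hM
  obtain ⟨⟨g, rfl⟩, hT, hnorm⟩ := hM0
  have hq1 : ∀ n : ℕ, Valued.v (ϖ ^ n) ≤ 1 := fun n => by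
    rw [map_pow]; exact pow_le_one₀ zero_le (by rw [hϖ, ← WithZero.exp_zero, WithZero.exp_le_exp]; omega)
  have hq_eq_one : ∀ n : ℕ, Valued.v (ϖ ^ n) = 1 → n = 0 := fun n h => by
    rw [map_pow, hϖ, ← WithZero.exp_nsmul, ← WithZero.exp_zero, WithZero.exp_inj] at h
    simp at h
    omega
  -- the HNF model
  have hle : latt (g : Matrix (Fin 3) (Fin 3) K) ≤ stdLattice K 3 := fun w hw => mem_stdLattice.2 fun i => (hnorm i).1 w hw
  obtain ⟨b, c, x, y, z, hx, hy, hz, hV⟩ := exists_latt_eq_latt_hnf hϖ g hle (hnorm 0).2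
  rw [hV] at hnorm hdual ha hT ⊢
  have hN := (normalised_latt_hnf_iff hx hy hz (hq1 b) (hq1 c)).1 hnorm
  have hxb : 1 ≤ b → Valued.v x = 1 := fun hb => hN.1.resolve_left fun h => by have := hq_eq_one b h; omega
  -- reading the axis vector of a candidate shape against `(2ρ+s, 2ρ+s, 2ρ)`
  have hax : ∀ {a' : Fin 3 → ℕ}, HasAxis ϖ (latt (Matrix.of ![![1, 0, 0], ![x, ϖ ^ b, 0], ![y, z, ϖ ^ c]])) a' →
      a' 0 = 2 * ρ + s ∧ a' 1 = 2 * ρ + s ∧ a' 2 = 2 * ρ := fun ha' => by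
    have h := hasAxis_unique hϖ ha' ha
    rw [h]
    simp
  -- the table
  rcases dualisable_strata hvσ hfix hϖ b c hx hy hz hnorm hdual with
    ⟨hb, hc⟩ | ⟨s', hc, hb, -, hs2⟩ | ⟨s', hb, hc, -, hs2, hzs, hy1⟩ | ⟨s', hb, hc, -, -, hz1, hw⟩ |
    ⟨ρ', s', hρ', hs2, h2s, hb, hc, hzρ, hy1, hw⟩ | ⟨ρ', s', hρ', hs2, h2s, hb, hc, hzρ, hy1⟩ | ⟨ρ', s', hρ', hs2, h2s, hc, hb, hzρ, hy1⟩ | ⟨ρ', hρ', hb, hc, hzρ, hy1, hw⟩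
  · exfalso; subst b; subst c
    have h := (hax (hasAxis_latt_hnf_core hϖ hx hy hz)).1
    simp at h; omega
  · exfalso; subst b; subst c
    have h := (hax (hasAxis_latt_hnf_T3 hϖ s' (hxb (by omega)) hy hz)).2.2
    simp at h; omega
  · exfalso; subst b; subst c
    have h := (hax (hasAxis_latt_hnf_T2 hϖ (by omega) hx hzs hy1)).2.1
    simp at h; omega
  · exfalso; subst b; subst c
    have h := (hax (hasAxis_latt_hnf_T1 hϖ s' hx hz1 hw)).1
    simp at h; omega
  · exfalso; subst b; subst c
    obtain ⟨h0, h1, -⟩ := hax (hasAxis_latt_hnf_G1 hϖ ρ' s' (hxb hρ') hzρ hw)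
    simp at h0 h1; omega
  · exfalso; subst b; subst c
    obtain ⟨h0, h1, -⟩ := hax (hasAxis_latt_hnf_G2 hϖ ρ' (by omega) (hxb hρ') hy1 hzρ)
    simp at h0 h1; omega
  · -- THE G₃ stratum: `ρ' = ρ`, `s' = s`
    subst b; subst c
    obtain ⟨h0, -, h2⟩ := hax (hasAxis_latt_hnf_G3 hϖ ρ' (by omega) (hxb (by omega)) hy1 hzρ)
    simp at h0 h2
    have hρρ : ρ' = ρ := by omega
    have hss : s' = s := by omega
    subst hρρ; subst hss
    exact ⟨x, y, z, hxb (by omega), hy1, hzρ, h2s, hs2, rfl, hT, hdual⟩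
  · exfalso; subst b; subst c
    obtain ⟨h0, -, h2⟩ := hax (hasAxis_latt_hnf_H hϖ ρ' (hxb hρ') hzρ hw)
    simp at h0 h2; omega

omit [Valued K ℤᵐ⁰] in
/-- The G₃ normal form is a `GL₃` lattice: `det (1 0 0; x ϖ^{ρ+s} 0; y z ϖ^{2ρ}) = ϖ^{ρ+s}·ϖ^{2ρ} ≠ 0`. [cite: Serre1980Trees, Ch. II §1.1] -/
theorem det_latt_G3_ne_zero {ϖ : K} (hϖ0 : ϖ ≠ 0) (x y z : K) (ρ s : ℕ) :
    (!![1, 0, 0; x, ϖ ^ (ρ + s), 0; y, z, ϖ ^ (2 * ρ)] : Matrix (Fin 3) (Fin 3) K).det ≠ 0 := by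
  rw [Matrix.det_fin_three]; simp [pow_ne_zero _ hϖ0]

/-- The G₃ normal form with `|x| = |y| = 1`, `|z| ≤ 1` (and `|ϖ| ≤ 1`) is NORMALISED (every coordinate ideal is `𝒪`). [cite: Kottwitz1986BaseChangeUnits, §1 pp. 240–241] -/
theorem isNormalisedLattice_latt_G3 {ϖ : K} (hϖ1 : Valued.v ϖ ≤ 1) {x y z : K} (hx : Valued.v x = 1) (hy : Valued.v y = 1) (hz : Valued.v z ≤ 1)
    (ρ s : ℕ) : IsNormalisedLattice (latt (!![1, 0, 0; x, ϖ ^ (ρ + s), 0; y, z, ϖ ^ (2 * ρ)] : Matrix (Fin 3) (Fin 3) K)) :=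
  (normalised_latt_hnf_iff (p := ϖ ^ (ρ + s)) (r := ϖ ^ (2 * ρ)) hx.le hy.le hz (by rw [map_pow]; exact pow_le_one' hϖ1 _)
    (by rw [map_pow]; exact pow_le_one' hϖ1 _)).2 ⟨Or.inr hx, Or.inr (Or.inl hy)⟩

/-- **THE STRATUM `(2ρ+s, 2ρ+s, 2ρ)` IS THE G₃ NORMAL-FORM SET** (LH4-p11 (g8) VERDICT-G3row §3 (m3)): for `ρ, s ≥ 1` and ANY `T ∈ GL₃(K)`,
`stratum σ ϖ T (2ρ+s, 2ρ+s, 2ρ) = {latt (1 0 0; x ϖ^{ρ+s} 0; y z ϖ^{2ρ}) : |x| = |y| = 1, |z| = |ϖ^ρ|, T-stable, dualisable}`.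
[cite: Kottwitz1986BaseChangeUnits, §1 pp. 240–241] [cite: Serre1980Trees, Ch. II §1.1] -/
theorem stratum_G3_eq {σ : K →+* K} (hvσ : ∀ a, Valued.v (σ a) = Valued.v a)
    (hfix : ∀ x : K, σ x = x → x ≠ 0 → ∃ n : ℤ, Valued.v x = WithZero.exp (2 * n)) {ϖ : K} (hϖ : Valued.v ϖ = WithZero.exp (-1 : ℤ))
    (T : GL (Fin 3) K) {ρ s : ℕ} (hρ : 1 ≤ ρ) (hs : 1 ≤ s) :
    stratum σ ϖ T ![2 * ρ + s, 2 * ρ + s, 2 * ρ] =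
      {M | ∃ x y z : K, Valued.v x = 1 ∧ Valued.v y = 1 ∧ Valued.v z = Valued.v (ϖ ^ ρ) ∧
        M = latt (!![1, 0, 0; x, ϖ ^ (ρ + s), 0; y, z, ϖ ^ (2 * ρ)] : Matrix (Fin 3) (Fin 3) K) ∧ mapGL T M = M ∧ IsDualisableLattice σ ϖ M} := by
  have hϖ0 : ϖ ≠ 0 := (Valuation.ne_zero_iff Valued.v).1 (by rw [hϖ]; exact WithZero.exp_ne_zero)
  have hϖ1 : Valued.v ϖ < 1 := by rw [hϖ, ← WithZero.exp_zero, WithZero.exp_lt_exp]; norm_num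
  have hq1 : ∀ n : ℕ, Valued.v (ϖ ^ n) ≤ 1 := fun n => by rw [map_pow]; exact pow_le_one₀ zero_le hϖ1.le
  ext M
  constructor
  · intro hM
    obtain ⟨x, y, z, hx1, hy1, hzρ, -, -, rfl, hT, hdual⟩ := exists_hnf_of_mem_stratum_G3 hvσ hfix hϖ T hρ hs hM
    exact ⟨x, y, z, hx1, hy1, hzρ, rfl, hT, hdual⟩
  · rintro ⟨x, y, z, hx1, hy1, hzρ, rfl, hT, hdual⟩
    refine (mem_stratum_iff σ ϖ T _ _).2 ⟨⟨⟨Matrix.GeneralLinearGroup.mkOfDetNeZero _ (det_latt_G3_ne_zero hϖ0 x y z ρ s), rfl⟩, hT, ?_⟩, hdual,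
      hasAxis_latt_hnf_G3 hϖ ρ hs hx1 hy1 hzρ⟩
    exact isNormalisedLattice_latt_G3 hϖ1.le hx1 hy1 (by rw [hzρ]; exact hq1 ρ) ρ s

/-- **A MEMBER OF THE STRATUM `(2ρ+s, 2ρ+s, 2ρ)` FORCES `s` EVEN** (★ B3: the axis exponents of a dualisable lattice are even). [cite: Kottwitz1986BaseChangeUnits, §1 pp. 240–241] -/
theorem two_dvd_of_mem_stratum_G3 {σ : K →+* K} (hvσ : ∀ a, Valued.v (σ a) = Valued.v a)
    (hfix : ∀ x : K, σ x = x → x ≠ 0 → ∃ n : ℤ, Valued.v x = WithZero.exp (2 * n)) {ϖ : K} (hϖ : Valued.v ϖ = WithZero.exp (-1 : ℤ))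
    (T : GL (Fin 3) K) {ρ s : ℕ} (hρ : 1 ≤ ρ) (hs : 1 ≤ s) {M : Submodule 𝒪[K] (Fin 3 → K)}
    (hM : M ∈ stratum σ ϖ T ![2 * ρ + s, 2 * ρ + s, 2 * ρ]) : 2 ∣ s := by
  obtain ⟨-, -, -, -, -, -, h2s, -⟩ := exists_hnf_of_mem_stratum_G3 hvσ hfix hϖ T hρ hs hM
  exact h2s

/-- **THE STRATUM `(2ρ+s, 2ρ+s, 2ρ)` IS EMPTY FOR ODD `s`** (convenience form). [cite: Kottwitz1986BaseChangeUnits, §1 pp. 240–241] -/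
theorem stratum_G3_eq_empty_of_odd {σ : K →+* K} (hvσ : ∀ a, Valued.v (σ a) = Valued.v a)
    (hfix : ∀ x : K, σ x = x → x ≠ 0 → ∃ n : ℤ, Valued.v x = WithZero.exp (2 * n)) {ϖ : K} (hϖ : Valued.v ϖ = WithZero.exp (-1 : ℤ))
    (T : GL (Fin 3) K) {ρ s : ℕ} (hρ : 1 ≤ ρ) (hs : ¬ 2 ∣ s) :
    stratum σ ϖ T ![2 * ρ + s, 2 * ρ + s, 2 * ρ] = ∅ := by
  refine Set.eq_empty_iff_forall_notMem.2 fun M hM => hs ?_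
  exact two_dvd_of_mem_stratum_G3 hvσ hfix hϖ T hρ (by omega) hM

/-! ## §2  Polarisation valuations on the G₃ normal form -/

/-- **POLARISATION VALUATIONS ON THE G₃ NORMAL FORM**: if `latt (1 0 0; x ϖ^{ρ+s} 0; y z ϖ^{2ρ})` (`|x| = |y| = 1`, `|z| = |ϖ^ρ|`, `ρ, s ≥ 1`) is a type-`0` vertex lattice of
`diag(D)` (`D_i ≠ 0`), then `|D₀| = |D₁| = exp(2ρ+s)` and `|D₂| = exp 2ρ` (★ `dualFrame_values` at `(b, c) = (ρ+s, 2ρ)`; the maxima are attained at the deep terms because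
`|xz − yϖ^{ρ+s}| = |ϖ|^ρ` and `ρ ≥ 1`). [cite: Jacobowitz1962, §4, §7] [cite: Kottwitz1986BaseChangeUnits, §1 pp. 240–241] -/
theorem v_polarisation_latt_G3 {σ : K →+* K} (hvσ : ∀ a, Valued.v (σ a) = Valued.v a) {ϖ : K} (hϖ : Valued.v ϖ = WithZero.exp (-1 : ℤ))
    {D : Fin 3 → K} (hD0 : ∀ i, D i ≠ 0) {ρ s : ℕ} (hρ : 1 ≤ ρ) (hs : 1 ≤ s) {x y z : K} (hx : Valued.v x = 1) (hy : Valued.v y = 1)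
    (hz : Valued.v z = Valued.v (ϖ ^ ρ))
    (hM : IsVertexLattice σ ϖ (Matrix.diagonal D) 0 (latt (!![1, 0, 0; x, ϖ ^ (ρ + s), 0; y, z, ϖ ^ (2 * ρ)] : Matrix (Fin 3) (Fin 3) K))) :
    Valued.v (D 0) = WithZero.exp ((2 * ρ + s : ℕ) : ℤ) ∧ Valued.v (D 1) = WithZero.exp ((2 * ρ + s : ℕ) : ℤ) ∧
      Valued.v (D 2) = WithZero.exp ((2 * ρ : ℕ) : ℤ) := by
  have hϖ1 : Valued.v ϖ < 1 := by rw [hϖ, ← WithZero.exp_zero, WithZero.exp_lt_exp]; norm_num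
  have hq : ∀ n : ℕ, Valued.v (ϖ ^ n) = WithZero.exp (-(n : ℤ)) := fun n => by
    rw [map_pow, hϖ, ← WithZero.exp_nsmul]; congr 1; simp
  have hform : (!![1, 0, 0; x, ϖ ^ (ρ + s), 0; y, z, ϖ ^ (2 * ρ)] : Matrix (Fin 3) (Fin 3) K) =
      Matrix.of ![![1, 0, 0], ![x, ϖ ^ (ρ + s), 0], ![y, z, ϖ ^ (2 * ρ)]] := rfl
  have hn := isNormalisedLattice_latt_G3 hϖ1.le hx hy (by rw [hz, hq, ← WithZero.exp_zero, WithZero.exp_le_exp]; omega) ρ s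
  rw [hform] at hn hM
  have hzle : Valued.v z ≤ 1 := by rw [hz, hq, ← WithZero.exp_zero, WithZero.exp_le_exp]; omega
  obtain ⟨h2, ⟨-, h1z, h1c⟩, ⟨-, -, h0w, h0c⟩⟩ := dualFrame_values hvσ hϖ hD0 (ρ + s) (2 * ρ) hx.le hy.le hzle hn hM
  -- `|z|·exp((ρ+s) + 2ρ) = exp(2ρ+s)` and `|xz − yϖ^{ρ+s}|·exp((ρ+s) + 2ρ) = exp(2ρ+s)`
  have hw : Valued.v (x * z - y * ϖ ^ (ρ + s)) = WithZero.exp (-(ρ : ℤ)) := by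
    rw [Valuation.map_sub_eq_of_lt_left _ ?_]
    · rw [map_mul, hx, one_mul, hz, hq]
    · rw [map_mul, hy, one_mul, hq, map_mul, hx, one_mul, hz, hq, WithZero.exp_lt_exp]; push_cast; omega
  have ez : Valued.v z * WithZero.exp (((ρ + s : ℕ) : ℤ) + ((2 * ρ : ℕ) : ℤ)) = WithZero.exp ((2 * ρ + s : ℕ) : ℤ) := by
    rw [hz, hq, ← WithZero.exp_add]; congr 1; push_cast; ring
  have ew : Valued.v (x * z - y * ϖ ^ (ρ + s)) * WithZero.exp (((ρ + s : ℕ) : ℤ) + ((2 * ρ : ℕ) : ℤ)) = WithZero.exp ((2 * ρ + s : ℕ) : ℤ) := by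
    rw [hw, ← WithZero.exp_add]; congr 1; push_cast; ring
  rw [ez] at h1z h1c
  rw [ew] at h0w h0c
  refine ⟨?_, ?_, h2⟩
  · rcases h0c with h | h | h
    · rw [h, ← WithZero.exp_zero, WithZero.exp_le_exp] at h0w; push_cast at h0w; omega
    · rw [h, hx, one_mul, WithZero.exp_le_exp] at h0w; push_cast at h0w; omega
    · exact h
  · rcases h1c with h | h
    · rw [h, WithZero.exp_le_exp] at h1z; push_cast at h1z; omega
    · exact h

/-! ## §3  The Gram cancellation `|D₀ + σx·D₁·x| = exp 2ρ` -/

/-- **THE GRAM CANCELLATION, `≤` FORM** (VERDICT-G3row §1): on the G₃ normal form (`|x| = |y| = 1`, `|z| = |ϖ^ρ|`, `ρ, s ≥ 1`) self-dual for `diag(D)`, the `(0,0)` Gram entry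
`D₀ + σx·D₁·x + σy·D₂·y` is integral (★ `gram_values`) and `|σy·D₂·y| = exp 2ρ` (§2), so `|D₀ + σx·D₁·x| ≤ exp 2ρ` — although `|D₀| = |σx·D₁·x| = exp(2ρ+s)`.
[cite: Jacobowitz1962, §4, §7] [cite: Kottwitz1986BaseChangeUnits, §1 pp. 240–241] -/
theorem v_gram_cancel_latt_G3_le {σ : K →+* K} (hvσ : ∀ a, Valued.v (σ a) = Valued.v a) {ϖ : K} (hϖ : Valued.v ϖ = WithZero.exp (-1 : ℤ))
    {D : Fin 3 → K} (hD0 : ∀ i, D i ≠ 0) {ρ s : ℕ} (hρ : 1 ≤ ρ) (hs : 1 ≤ s) {x y z : K} (hx : Valued.v x = 1) (hy : Valued.v y = 1)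
    (hz : Valued.v z = Valued.v (ϖ ^ ρ))
    (hM : IsVertexLattice σ ϖ (Matrix.diagonal D) 0 (latt (!![1, 0, 0; x, ϖ ^ (ρ + s), 0; y, z, ϖ ^ (2 * ρ)] : Matrix (Fin 3) (Fin 3) K))) :
    Valued.v (D 0 + σ x * D 1 * x) ≤ WithZero.exp ((2 * ρ : ℕ) : ℤ) := by
  have hϖ0 : ϖ ≠ 0 := (Valuation.ne_zero_iff Valued.v).1 (by rw [hϖ]; exact WithZero.exp_ne_zero)
  obtain ⟨-, -, h2⟩ := v_polarisation_latt_G3 hvσ hϖ hD0 hρ hs hx hy hz hM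
  have hform : (!![1, 0, 0; x, ϖ ^ (ρ + s), 0; y, z, ϖ ^ (2 * ρ)] : Matrix (Fin 3) (Fin 3) K) =
      Matrix.of ![![1, 0, 0], ![x, ϖ ^ (ρ + s), 0], ![y, z, ϖ ^ (2 * ρ)]] := rfl
  rw [hform] at hM
  obtain ⟨-, hG00, -⟩ := gram_values hvσ hϖ0 D (ρ + s) (2 * ρ) x y z hM
  have hyDy : Valued.v (σ y * D 2 * y) = WithZero.exp ((2 * ρ : ℕ) : ℤ) := by rw [map_mul, map_mul, hvσ, hy, h2, one_mul, mul_one]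
  have h1le : (1 : ℤᵐ⁰) ≤ WithZero.exp ((2 * ρ : ℕ) : ℤ) := by rw [← WithZero.exp_zero, WithZero.exp_le_exp]; positivity
  calc Valued.v (D 0 + σ x * D 1 * x) = Valued.v ((D 0 + σ x * D 1 * x + σ y * D 2 * y) - σ y * D 2 * y) := by rw [add_sub_cancel_right]
    _ ≤ max (Valued.v (D 0 + σ x * D 1 * x + σ y * D 2 * y)) (Valued.v (σ y * D 2 * y)) := Valuation.map_sub _ _ _
    _ ≤ WithZero.exp ((2 * ρ : ℕ) : ℤ) := max_le (hG00.trans h1le) hyDy.le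

/-- **THE GRAM CANCELLATION IS EXACT**: under the same hypotheses `|D₀ + σx·D₁·x| = exp 2ρ` (`ρ ≥ 1`: the integral Gram entry is strictly smaller than `|σy·D₂·y| = exp 2ρ`).
[cite: Jacobowitz1962, §4, §7] -/
theorem v_gram_cancel_latt_G3_eq {σ : K →+* K} (hvσ : ∀ a, Valued.v (σ a) = Valued.v a) {ϖ : K} (hϖ : Valued.v ϖ = WithZero.exp (-1 : ℤ))
    {D : Fin 3 → K} (hD0 : ∀ i, D i ≠ 0) {ρ s : ℕ} (hρ : 1 ≤ ρ) (hs : 1 ≤ s) {x y z : K} (hx : Valued.v x = 1) (hy : Valued.v y = 1)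
    (hz : Valued.v z = Valued.v (ϖ ^ ρ))
    (hM : IsVertexLattice σ ϖ (Matrix.diagonal D) 0 (latt (!![1, 0, 0; x, ϖ ^ (ρ + s), 0; y, z, ϖ ^ (2 * ρ)] : Matrix (Fin 3) (Fin 3) K))) :
    Valued.v (D 0 + σ x * D 1 * x) = WithZero.exp ((2 * ρ : ℕ) : ℤ) := by
  have hϖ0 : ϖ ≠ 0 := (Valuation.ne_zero_iff Valued.v).1 (by rw [hϖ]; exact WithZero.exp_ne_zero)
  obtain ⟨-, -, h2⟩ := v_polarisation_latt_G3 hvσ hϖ hD0 hρ hs hx hy hz hM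
  have hform : (!![1, 0, 0; x, ϖ ^ (ρ + s), 0; y, z, ϖ ^ (2 * ρ)] : Matrix (Fin 3) (Fin 3) K) =
      Matrix.of ![![1, 0, 0], ![x, ϖ ^ (ρ + s), 0], ![y, z, ϖ ^ (2 * ρ)]] := rfl
  rw [hform] at hM
  obtain ⟨-, hG00, -⟩ := gram_values hvσ hϖ0 D (ρ + s) (2 * ρ) x y z hM
  have hyDy : Valued.v (σ y * D 2 * y) = WithZero.exp ((2 * ρ : ℕ) : ℤ) := by rw [map_mul, map_mul, hvσ, hy, h2, one_mul, mul_one]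
  have hlt : Valued.v (D 0 + σ x * D 1 * x + σ y * D 2 * y) < Valued.v (σ y * D 2 * y) :=
    hG00.trans_lt (by rw [hyDy, ← WithZero.exp_zero, WithZero.exp_lt_exp]; push_cast; omega)
  rw [show D 0 + σ x * D 1 * x = (D 0 + σ x * D 1 * x + σ y * D 2 * y) - σ y * D 2 * y by ring, Valuation.map_sub_eq_of_lt_right _ hlt, hyDy]

/-! ## §4  (m2) The diagonal stabilisers of the G₃ normal form -/

/-- **`T`-STABILITY OF THE G₃ NORMAL FORM UNDER A UNIT DIAGONAL `T = diag(u)`** (★ `mapGL_latt_hnf_eq_iff` at `(b, c) = (ρ+s, 2ρ)`, `|x| = 1`, `|z| = |ϖ^ρ|`, any corner entry `y`):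
`T·M = M ⟺ (a) |u₁−u₀| ≤ |ϖ^{ρ+s}| ∧ (b) |u₂−u₁| ≤ |ϖ^ρ| ∧ (c) |(u₂−u₀)·y·ϖ^{ρ+s} + (u₀−u₁)·x·z| ≤ |ϖ^{3ρ+s}|`.
[cite: Serre1980Trees, Ch. II §1.1] [cite: Kottwitz1986BaseChangeUnits, §1 pp. 240–241] -/
theorem mapGL_latt_G3_eq_iff {ϖ : K} (hϖ0 : ϖ ≠ 0) (u : Fin 3 → K) (hu : ∀ i, Valued.v (u i) = 1) (T : GL (Fin 3) K)
    (hT : (T : Matrix (Fin 3) (Fin 3) K) = Matrix.diagonal u) {x z : K} (hx : Valued.v x = 1) (y : K) {ρ s : ℕ}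
    (hz : Valued.v z = Valued.v (ϖ ^ ρ)) :
    mapGL T (latt (!![1, 0, 0; x, ϖ ^ (ρ + s), 0; y, z, ϖ ^ (2 * ρ)] : Matrix (Fin 3) (Fin 3) K)) =
        latt (!![1, 0, 0; x, ϖ ^ (ρ + s), 0; y, z, ϖ ^ (2 * ρ)] : Matrix (Fin 3) (Fin 3) K) ↔
      Valued.v (u 1 - u 0) ≤ Valued.v (ϖ ^ (ρ + s)) ∧ Valued.v (u 2 - u 1) ≤ Valued.v (ϖ ^ ρ) ∧
        Valued.v ((u 2 - u 0) * y * ϖ ^ (ρ + s) + (u 0 - u 1) * x * z) ≤ Valued.v (ϖ ^ (3 * ρ + s)) := by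
  have hvϖ : 0 < Valued.v ϖ := (Valuation.pos_iff _).2 hϖ0
  have hb : (ϖ ^ (ρ + s) : K) ≠ 0 := pow_ne_zero _ hϖ0
  have hc : (ϖ ^ (2 * ρ) : K) ≠ 0 := pow_ne_zero _ hϖ0
  have hvb : 0 < Valued.v (ϖ ^ (ρ + s)) := (Valuation.pos_iff _).2 hb
  have hvc : 0 < Valued.v (ϖ ^ (2 * ρ)) := (Valuation.pos_iff _).2 hc
  have hV : ((Matrix.GeneralLinearGroup.mkOfDetNeZero _ (det_latt_G3_ne_zero hϖ0 x y z ρ s) : GL (Fin 3) K) : Matrix (Fin 3) (Fin 3) K) =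
      !![1, 0, 0; x, ϖ ^ (ρ + s), 0; y, z, ϖ ^ (2 * ρ)] := rfl
  have h := mapGL_latt_hnf_eq_iff hϖ0 u hu T hT _ hV
  rw [show latt (!![1, 0, 0; x, ϖ ^ (ρ + s), 0; y, z, ϖ ^ (2 * ρ)] : Matrix (Fin 3) (Fin 3) K) =
      latt ((Matrix.GeneralLinearGroup.mkOfDetNeZero _ (det_latt_G3_ne_zero hϖ0 x y z ρ s) : GL (Fin 3) K) : Matrix (Fin 3) (Fin 3) K) from rfl, h]
  refine and_congr ?_ (and_congr ?_ ?_)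
  · rw [map_mul, map_inv₀, mul_inv_le_iff₀ hvb, one_mul, map_mul, hx, mul_one]
  · rw [map_mul, map_inv₀, mul_inv_le_iff₀ hvc, one_mul, map_mul, hz, map_pow, map_pow,
      show Valued.v ϖ ^ (2 * ρ) = Valued.v ϖ ^ ρ * Valued.v ϖ ^ ρ by rw [← pow_add]; congr 1; ring]
    exact mul_le_mul_iff_left₀ (pow_pos hvϖ _)
  · have e3 : ((u 2 - u 0) * y + (u 0 - u 1) * x * z * (ϖ ^ (ρ + s))⁻¹) * (ϖ ^ (2 * ρ))⁻¹ =
        ((u 2 - u 0) * y * ϖ ^ (ρ + s) + (u 0 - u 1) * x * z) * (ϖ ^ (ρ + s) * ϖ ^ (2 * ρ))⁻¹ := by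
      field_simp
    have hbc : 0 < Valued.v (ϖ ^ (ρ + s) * ϖ ^ (2 * ρ)) := (Valuation.pos_iff _).2 (mul_ne_zero hb hc)
    rw [e3, map_mul, map_inv₀, mul_inv_le_iff₀ hbc, one_mul, ← pow_add, show ρ + s + 2 * ρ = 3 * ρ + s by ring]

/-- **THE DIAGONAL STABILISER OF THE G₃ NORMAL FORM AMONG UNIT VECTORS**: for `|u_i| = 1`, `diag(u)·M = M ⟺ (a) ∧ (b) ∧ (c)` of `mapGL_latt_G3_eq_iff`.
[cite: Kottwitz1986BaseChangeUnits, §1 pp. 240–241] -/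
theorem mem_latticeStabilizer_latt_G3_iff {ϖ : K} (hϖ0 : ϖ ≠ 0) {x z : K} (hx : Valued.v x = 1) (y : K) {ρ s : ℕ}
    (hz : Valued.v z = Valued.v (ϖ ^ ρ)) {u : Fin 3 → Kˣ} (hu : ∀ i, Valued.v (u i : K) = 1) :
    u ∈ latticeStabilizer (latt (!![1, 0, 0; x, ϖ ^ (ρ + s), 0; y, z, ϖ ^ (2 * ρ)] : Matrix (Fin 3) (Fin 3) K)) ↔
      Valued.v ((u 1 : K) - u 0) ≤ Valued.v (ϖ ^ (ρ + s)) ∧ Valued.v ((u 2 : K) - u 1) ≤ Valued.v (ϖ ^ ρ) ∧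
        Valued.v (((u 2 : K) - u 0) * y * ϖ ^ (ρ + s) + ((u 0 : K) - u 1) * x * z) ≤ Valued.v (ϖ ^ (3 * ρ + s)) := by
  rw [mem_latticeStabilizer_iff]
  exact mapGL_latt_G3_eq_iff hϖ0 (fun i => (u i : K)) hu (diagGLUnits u) (coe_diagGLUnits u) hx y hz

/-- `S̃(M) = {u ∈ 𝒯 : (a) ∧ (b) ∧ (c)}` for the G₃ normal form `M`. [cite: Kottwitz1986BaseChangeUnits, §1 pp. 240–241] -/
theorem mem_unitStabilizer_latt_G3_iff {ϖ : K} (hϖ0 : ϖ ≠ 0) {x z : K} (hx : Valued.v x = 1) (y : K) {ρ s : ℕ}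
    (hz : Valued.v z = Valued.v (ϖ ^ ρ)) (u : Fin 3 → Kˣ) :
    u ∈ unitStabilizer (latt (!![1, 0, 0; x, ϖ ^ (ρ + s), 0; y, z, ϖ ^ (2 * ρ)] : Matrix (Fin 3) (Fin 3) K)) ↔
      u ∈ unitTorus K 3 ∧ Valued.v ((u 1 : K) - u 0) ≤ Valued.v (ϖ ^ (ρ + s)) ∧ Valued.v ((u 2 : K) - u 1) ≤ Valued.v (ϖ ^ ρ) ∧
        Valued.v (((u 2 : K) - u 0) * y * ϖ ^ (ρ + s) + ((u 0 : K) - u 1) * x * z) ≤ Valued.v (ϖ ^ (3 * ρ + s)) := by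
  rw [F0P3cDyRamDiagonalTorusDefs.unitStabilizer, Subgroup.mem_inf]
  exact ⟨fun ⟨h1, h2⟩ => ⟨h2, (mem_latticeStabilizer_latt_G3_iff hϖ0 hx y hz ((mem_unitTorus_iff u).1 h2)).1 h1⟩,
    fun ⟨h2, h1⟩ => ⟨(mem_latticeStabilizer_latt_G3_iff hϖ0 hx y hz ((mem_unitTorus_iff u).1 h2)).2 h1, h2⟩⟩

/-- **`S_F(M)` ON THE G₃ NORMAL FORM** (LH4-p11 (g8) VERDICT-G3row §3 (m2)): `u ∈ S_F(M) ⟺ u ∈ 𝒰 ∧ (a) |u₁−u₀| ≤ |ϖ^{ρ+s}| ∧ (b) |u₂−u₁| ≤ |ϖ^ρ| ∧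
(c) |(u₂−u₀)·y·ϖ^{ρ+s} + (u₀−u₁)·x·z| ≤ |ϖ^{3ρ+s}|`. [cite: Kottwitz1986BaseChangeUnits, §1 pp. 240–241] -/
theorem mem_fixedUnitStabilizer_latt_G3_iff (σ : K →+* K) {ϖ : K} (hϖ0 : ϖ ≠ 0) {x z : K} (hx : Valued.v x = 1) (y : K) {ρ s : ℕ}
    (hz : Valued.v z = Valued.v (ϖ ^ ρ)) (u : Fin 3 → Kˣ) :
    u ∈ fixedUnitStabilizer σ (latt (!![1, 0, 0; x, ϖ ^ (ρ + s), 0; y, z, ϖ ^ (2 * ρ)] : Matrix (Fin 3) (Fin 3) K)) ↔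
      u ∈ fixedUnitTorus σ 3 ∧ Valued.v ((u 1 : K) - u 0) ≤ Valued.v (ϖ ^ (ρ + s)) ∧ Valued.v ((u 2 : K) - u 1) ≤ Valued.v (ϖ ^ ρ) ∧
        Valued.v (((u 2 : K) - u 0) * y * ϖ ^ (ρ + s) + ((u 0 : K) - u 1) * x * z) ≤ Valued.v (ϖ ^ (3 * ρ + s)) := by
  rw [fixedUnitStabilizer, Subgroup.mem_inf]
  exact ⟨fun ⟨h1, h2⟩ => ⟨h2, (mem_latticeStabilizer_latt_G3_iff hϖ0 hx y hz ((mem_fixedUnitTorus_iff σ u).1 h2).1).1 h1⟩,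
    fun ⟨h2, h1⟩ => ⟨(mem_latticeStabilizer_latt_G3_iff hϖ0 hx y hz ((mem_fixedUnitTorus_iff σ u).1 h2).1).2 h1, h2⟩⟩

/-- **WHAT THE (P2a) READ USES**: a fixed diagonal stabiliser element `u ∈ S_F(M)` of the G₃ normal form satisfies `|u₁−u₀| ≤ |ϖ^{ρ+s}|`, `|u₂−u₁| ≤ |ϖ^ρ|` and
`|u₂−u₀| ≤ |ϖ^ρ|` (VERDICT-G3row §1: the error term `(u₁−u₀)·D₁N(x)·(β−1)` of the label form is `ϖ^{m*}`-small in the cell). [cite: Kottwitz1986BaseChangeUnits, §1 pp. 240–241] -/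
theorem v_sub_le_of_mem_fixedUnitStabilizer_latt_G3 (σ : K →+* K) {ϖ : K} (hϖ0 : ϖ ≠ 0) (hϖ1 : Valued.v ϖ ≤ 1) {x z : K} (hx : Valued.v x = 1)
    {y : K} {ρ s : ℕ} (hz : Valued.v z = Valued.v (ϖ ^ ρ)) {u : Fin 3 → Kˣ}
    (hu : u ∈ fixedUnitStabilizer σ (latt (!![1, 0, 0; x, ϖ ^ (ρ + s), 0; y, z, ϖ ^ (2 * ρ)] : Matrix (Fin 3) (Fin 3) K))) :
    Valued.v ((u 1 : K) - u 0) ≤ Valued.v (ϖ ^ (ρ + s)) ∧ Valued.v ((u 2 : K) - u 1) ≤ Valued.v (ϖ ^ ρ) ∧ Valued.v ((u 2 : K) - u 0) ≤ Valued.v (ϖ ^ ρ) := by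
  obtain ⟨-, ha, hb, -⟩ := (mem_fixedUnitStabilizer_latt_G3_iff σ hϖ0 hx y hz u).1 hu
  refine ⟨ha, hb, ?_⟩
  have hab : Valued.v (ϖ ^ (ρ + s)) ≤ Valued.v (ϖ ^ ρ) := by
    rw [map_pow, map_pow, pow_add]; exact mul_le_of_le_one_right' (pow_le_one' hϖ1 _)
  rw [show (u 2 : K) - u 0 = ((u 2 : K) - u 1) + ((u 1 : K) - u 0) by ring]
  exact (Valuation.map_add _ _ _).trans (max_le hb (ha.trans hab))

end Summit.HodgeConjecture.HodgeConjecture.Cruxes.H413.F0P3cDyRamDiagonalGluedStratumG3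

end
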